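import Mathlib
import HarnessLib
import Literature.MathematicalPhysics.QuantumLattice.HubbardGridFieldSubstitution
import Literature.MathematicalPhysics.QuantumLattice.HubbardInteractionMoments
import Summits.HubbardSuperconductivity.HubbardSuperconductivity.Theorems.KLProgrammeKLRegimeSplitTwoLegMomentsOffDiag
import Summits.HubbardSuperconductivity.HubbardSuperconductivity.Theorems.KLProgrammeKLRegimeSplitTwoLegCounterVertex
import Summits.HubbardSuperconductivity.HubbardSuperconductivity.Theorems.KLProgrammeKLRegimeSplitSymInterpExact

/-!
# Route `KLProgramme` — ENGINE child 19918, two-leg slot: the (M1) Fourier bridge straight from a GRID representation —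
# coefficient moments of `k⃗ ↦ Re Σ_G((ω,k⃗),σ)` for `G = map (gridSub) W` from the pinned weighted sums of `W`'s OWN two-leg kernel

Cell `gate-hubbard-kl`, seat p1b (g7).  The engine's single-scale step at scale `0` is RUN on the `4M`-point time grid (k3c2-p1's W-chain:
`𝒱⁽⁰⁾ = effAction C₀ (map S Ṽ)`, `S = hubbardGridSub β (4M)`), and its decay-weighted output bounds (`GrassmannWeightedEffectiveActionBound`,
`…Truncation.sum_wt_norm_kernel_effAction_sub_gaussConv_le`) are bounds on the kernels of the GRID element.  The two-leg slot's (M1) bridge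
of record (`…TwoLegMomentsFromPosition`, `…TwoLegMomentsOffDiag`) reads the DUAL-LATTICE position kernel `sectorisedKernel β (trivialMultiplier) G`,
and passing grid → dual lattice through the trivial-multiplier analysis map costs a Dirichlet-kernel `log M` (memo SCALE0-TWOLEG-EXPORTS.md v4 caveat).
This file avoids the dual lattice: Fourier inversion from the grid representation itself (`S = gridSubMatrix L M β x τ`, `G := map (toLin' S) W`):
* `kernel_two_map_gridSub` — `kernel G 2 ((K,σ,+),(K,σ,−)) = (βL²)⁻² Σ_{p₀,p₁} e^{iω(τ_{p₀} − τ_{p₁})} χ_{k⃗}(x⃗_{p₀} − x⃗_{p₁}) · kernel W 2 ((p₀,σ,+),(p₁,σ,−))`;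
* `norm_sum_selfEnergy_map_gridSub_mul_torusChar_le` — `‖Σ_{k⃗} Σ_G((ω,k⃗),σ) χ_{k⃗}(y)‖ ≤ (2/|β|) Σ_{p : x⃗_{p₀} − x⃗_{p₁} + y = 0} ‖kernel W 2 (p)‖`;
* `abs_torusCosCoeff_re_selfEnergy_map_gridSub_le` — the pointwise coefficient bound;
* **`sum_evenWeight_abs_torusCosCoeff_re_selfEnergy_map_gridSub_le`** — for an even weight `w ≥ 0`: if for every grid point `p₀`
  `Σ_{p₁} w(x⃗_{p₁} − x⃗_{p₀}) ‖kernel W 2 ((p₀,σ,+),(p₁,σ,−))‖ ≤ B`, then `Σ_y w(y) |torusCosCoeff L (Re Σ_G((ω,·),σ)) y| ≤ (2·|P|/(|β|·L²))·B`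
  (`N`-point time grid: `|P| = N·L²`, constant `2N/|β| = 2/ε_grid`) — M-UNIFORM, no analysis map;
* **`sum_evenWeight_abs_torusCosCoeff_locRe_map_gridSub_le`** — the same for the localised data `¼Σ_σ[Re Σ(ω₀,·) + Re Σ(−ω₀,·)]`.
* **`twoLeg_sep_momentumSizes_of_grid`** — if `𝒱⁽ⁿ⁾ − 𝒩_K = map S W`: the momentum-side sizes `‖Dᵏ evalM (symInterp L (σ_n − K∘p))‖ ≤ (2|P|/(|β|L²))·Bₖ`
  (k ≤ 2; `B₀` plain, `B₁, B₂` OFF-DIAGONAL weighted pinned grid sums) — the input `hm` of `twoLegCoreT_zero_of_momentumSizes` (`…TwoLegCoreTMomentum`);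
* **`abs_scaleZero_response_le_of_grid`** — the scale-0 (E3c) response of band-limited frames from a grid element representing
  `(𝒱⁽⁰⁾_K − 𝒩_K) − (𝒱⁽⁰⁾_{K'} − 𝒩_{K'})` (input `hr₀`).

Proofs only; no definitions; nothing about the model is asserted.  References: BGM 2006 §2.1 (2.5), §2.3 (2.17) [cite: BenfattoGiulianiMastropietro2006].
-/

noncomputable section

namespace Summit.HubbardSuperconductivity.HubbardSuperconductivity.Theorems.TwoLegFourier

set_option linter.dupNamespace false -- summit = problem name (single-conjunct summit), D-0017

open Finset Complex
open Literature.MathematicalPhysics.QuantumLattice Literature.Probability.LatticeModels GrassmannAlgebra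
open Summit.HubbardSuperconductivity.HubbardSuperconductivity.Theorems.KLRegimeSplit
open Summit.HubbardSuperconductivity.HubbardSuperconductivity.Theorems.KLProgrammeLegKernels

variable {L M : ℕ} [NeZero L] {P : Type*} [Fintype P] [DecidableEq P]

/-! ## §1 The two-leg kernel of a grid-substituted element at a `(K,σ)` string -/

omit [NeZero L] [DecidableEq P] in
/-- Sums over grid-leg tuples vanishing off prescribed spins/charges reduce to sums over point tuples. -/
theorem sum_gridLeg_tuple_eq {A : Type*} [AddCommMonoid A] {m : ℕ} (σ c : Fin m → Fin 2)
    (g : (Fin m → GridLeg P) → A) (hg : ∀ Y, (∃ i, ¬((Y i).1.2 = σ i ∧ (Y i).2 = c i)) → g Y = 0) :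
    ∑ Y, g Y = ∑ p : Fin m → P, g (fun i => ((p i, σ i), c i)) := by
  classical
  set emb : (Fin m → P) → (Fin m → GridLeg P) := fun k i => ((k i, σ i), c i) with hemb
  have hinj : Function.Injective emb := fun k k' h => funext fun i => by
    have := congrFun h i
    simp only [hemb, Prod.mk.injEq] at this
    exact this.1.1
  rw [← sum_image (f := g) fun k _ k' _ h => hinj h]
  symm
  refine sum_subset (subset_univ _) fun Y _ hY => hg Y ?_
  by_contra hall
  push Not at hall
  refine hY (mem_image.2 ⟨fun i => (Y i).1.1, mem_univ _, funext fun i => ?_⟩)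
  obtain ⟨h1, h2⟩ := hall i
  simp only [hemb]
  rw [← h1, ← h2]

/-- **The two-leg kernel of `map S W` at the string `((K,σ),+),((K,σ),−)`** (`S = gridSubMatrix β x τ`):
`(βL²)⁻² Σ_{p₀,p₁} e^{iω(τ_{p₀} − τ_{p₁})} χ_{k⃗}(x⃗_{p₀} − x⃗_{p₁}) · kernel W 2 ((p₀,σ,+),(p₁,σ,−))`. -/
theorem kernel_two_map_gridSub (β : ℝ) (x : P → TorusSite 2 L) (τ : P → ℝ) (W : GrassmannAlgebra ℂ (GridLeg P))
    (K : FreqMomentum L M) (σ : Fin 2) :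
    kernel ℂ (ExteriorAlgebra.map (Matrix.toLin' (gridSubMatrix L M β x τ)) W) 2
        (![((K, σ), 0), ((K, σ), 1)] : Fin 2 → HubbardFieldIdx L M) =
      ∑ p : Fin 2 → P, ((1 / (β * (L : ℝ) ^ 2) : ℝ) : ℂ) ^ 2 *
        (Complex.exp (((matsubaraFreq β M K.1 * (τ (p 0) - τ (p 1)) : ℝ) : ℂ) * Complex.I) * torusChar K.2 (x (p 0) - x (p 1))) *
          kernel ℂ W 2 (fun i => ((p i, σ), i)) := by
  have hX1 : ∀ j : Fin 2, ((![((K, σ), 0), ((K, σ), 1)] : Fin 2 → HubbardFieldIdx L M) j).1.2 = σ := by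
    intro j; fin_cases j <;> rfl
  have hX2 : ∀ j : Fin 2, ((![((K, σ), 0), ((K, σ), 1)] : Fin 2 → HubbardFieldIdx L M) j).2 = j := by
    intro j; fin_cases j <;> rfl
  have hX0 : ∀ j : Fin 2, ((![((K, σ), 0), ((K, σ), 1)] : Fin 2 → HubbardFieldIdx L M) j).1.1 = K := by
    intro j; fin_cases j <;> rfl
  rw [kernel_map, LinearMap.toMatrix'_toLin']
  rw [sum_gridLeg_tuple_eq (fun _ => σ) (fun i => i)]
  · refine sum_congr rfl fun p _ => ?_
    rw [Fin.prod_univ_two]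
    simp only [gridSubMatrix_apply, Matrix.cons_val_zero, Matrix.cons_val_one, and_self, if_true]
    rw [conj_vertexPlaneWave_zero_eq, conj_vertexPlaneWave_one_eq, torusChar_sub_right]
    rw [show Complex.exp (((matsubaraFreq β M K.1 * (τ (p 0) - τ (p 1)) : ℝ) : ℂ) * Complex.I) =
        Complex.exp (((matsubaraFreq β M K.1 * τ (p 0) : ℝ) : ℂ) * Complex.I) *
          Complex.exp (-(((matsubaraFreq β M K.1 * τ (p 1) : ℝ) : ℂ) * Complex.I)) by rw [← Complex.exp_add]; congr 1; push_cast; ring]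
    ring
  · rintro Y ⟨i, hi⟩
    have hz : gridSubMatrix L M β x τ ((![((K, σ), 0), ((K, σ), 1)] : Fin 2 → HubbardFieldIdx L M) i) (Y i) = 0 := by
      rw [gridSubMatrix_apply]
      exact if_neg fun h => hi ⟨h.1.symm.trans (hX1 i), h.2.symm.trans (hX2 i)⟩
    rw [Finset.prod_eq_zero (Finset.mem_univ i) hz, zero_mul]

/-! ## §2 Testing against a spatial character; the coefficient bound -/

/-- **The self-energy of `map S W` tested against a spatial character**:
`Σ_{k⃗} Σ((ω,k⃗),σ) χ_{k⃗}(y) = (2/β) Σ_{p : x⃗_{p₀} − x⃗_{p₁} + y = 0} e^{iω(τ_{p₀} − τ_{p₁})} kernel W 2 (p)`. -/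
theorem sum_selfEnergy_map_gridSub_mul_torusChar [NeZero M] {β : ℝ} (hβ : β ≠ 0) (x : P → TorusSite 2 L) (τ : P → ℝ)
    (W : GrassmannAlgebra ℂ (GridLeg P)) (n : MatsubaraIdx M) (σ : Fin 2) (y : TorusSite 2 L) :
    ∑ k : TorusSite 2 L, selfEnergy L M β (ExteriorAlgebra.map (Matrix.toLin' (gridSubMatrix L M β x τ)) W) (n, k) σ * torusChar k y =
      ((2 / β : ℝ) : ℂ) * ∑ p : Fin 2 → P, if x (p 0) - x (p 1) + y = 0 then
        Complex.exp (((matsubaraFreq β M n * (τ (p 0) - τ (p 1)) : ℝ) : ℂ) * Complex.I) * kernel ℂ W 2 (fun i => ((p i, σ), i))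
        else 0 := by
  have hL : ((L : ℂ) ^ 2) ≠ 0 := natCast_pow_ne_zero
  have hβc : (β : ℂ) ≠ 0 := Complex.ofReal_ne_zero.2 hβ
  simp_rw [selfEnergy_eq_vertexFn, kernel_two_map_gridSub, mul_sum, sum_mul]
  rw [sum_comm]
  refine sum_congr rfl fun p _ => ?_
  have hchar : ∀ k : TorusSite 2 L, torusChar k (x (p 0) - x (p 1)) * torusChar k y = torusChar k (x (p 0) - x (p 1) + y) := fun k => by
    rw [torusChar_add_right]
  have hterm : ∀ k : TorusSite 2 L,
      (((2 * (β * (L : ℝ) ^ 2) : ℝ) : ℂ)) * (((1 / (β * (L : ℝ) ^ 2) : ℝ) : ℂ) ^ 2 *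
        (Complex.exp (((matsubaraFreq β M n * (τ (p 0) - τ (p 1)) : ℝ) : ℂ) * Complex.I) * torusChar k (x (p 0) - x (p 1))) *
          kernel ℂ W 2 (fun i => ((p i, σ), i))) * torusChar k y =
      ((2 / β : ℝ) : ℂ) * ((L : ℂ) ^ 2)⁻¹ *
        (Complex.exp (((matsubaraFreq β M n * (τ (p 0) - τ (p 1)) : ℝ) : ℂ) * Complex.I) * kernel ℂ W 2 (fun i => ((p i, σ), i))) *
          torusChar k (x (p 0) - x (p 1) + y) := by
    intro k
    rw [← hchar k]
    push_cast
    field_simp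
  have key : ∀ a E : ℂ, a * ((L : ℂ) ^ 2)⁻¹ * E * (L : ℂ) ^ 2 = a * E := fun a E => by
    rw [mul_comm (a * ((L : ℂ) ^ 2)⁻¹) E, mul_assoc, mul_assoc, inv_mul_cancel₀ hL, mul_one, mul_comm]
  simp_rw [hterm]
  rw [← mul_sum, sum_torusChar_left]
  split_ifs with h
  · exact key _ _
  · simp

/-- Norm form: `‖Σ_{k⃗} Σ((ω,k⃗),σ) χ_{k⃗}(y)‖ ≤ (2/|β|) Σ_{p : x⃗_{p₀} − x⃗_{p₁} + y = 0} ‖kernel W 2 (p)‖`. -/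
theorem norm_sum_selfEnergy_map_gridSub_mul_torusChar_le [NeZero M] {β : ℝ} (hβ : β ≠ 0) (x : P → TorusSite 2 L) (τ : P → ℝ)
    (W : GrassmannAlgebra ℂ (GridLeg P)) (n : MatsubaraIdx M) (σ : Fin 2) (y : TorusSite 2 L) :
    ‖∑ k : TorusSite 2 L, selfEnergy L M β (ExteriorAlgebra.map (Matrix.toLin' (gridSubMatrix L M β x τ)) W) (n, k) σ * torusChar k y‖ ≤
      2 / |β| * ∑ p : Fin 2 → P, if x (p 0) - x (p 1) + y = 0 then ‖kernel ℂ W 2 (fun i => ((p i, σ), i))‖ else 0 := by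
  rw [sum_selfEnergy_map_gridSub_mul_torusChar hβ, norm_mul, Complex.norm_real, Real.norm_eq_abs, abs_div, abs_two]
  refine mul_le_mul_of_nonneg_left ((norm_sum_le _ _).trans (sum_le_sum fun p _ => ?_)) (by positivity)
  split_ifs
  · rw [norm_mul, Complex.norm_exp_ofReal_mul_I, one_mul]
  · rw [norm_zero]

/-- **Pointwise coefficient bound from the grid kernel**:
`|torusCosCoeff L (k⃗ ↦ Re Σ((ω,k⃗),σ)) y| ≤ (1/(|β|L²)) · (Σ_{p : Δx⃗ + y = 0} + Σ_{p : Δx⃗ − y = 0}) ‖kernel W 2 (p)‖`, `Δx⃗ = x⃗_{p₀} − x⃗_{p₁}`. -/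
theorem abs_torusCosCoeff_re_selfEnergy_map_gridSub_le [NeZero M] {β : ℝ} (hβ : β ≠ 0) (x : P → TorusSite 2 L) (τ : P → ℝ)
    (W : GrassmannAlgebra ℂ (GridLeg P)) (n : MatsubaraIdx M) (σ : Fin 2) (y : TorusSite 2 L) :
    |torusCosCoeff L (fun k => (selfEnergy L M β (ExteriorAlgebra.map (Matrix.toLin' (gridSubMatrix L M β x τ)) W) (n, k) σ).re) y| ≤
      1 / (|β| * (L : ℝ) ^ 2) *
        ((∑ p : Fin 2 → P, if x (p 0) - x (p 1) + y = 0 then ‖kernel ℂ W 2 (fun i => ((p i, σ), i))‖ else 0) +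
         (∑ p : Fin 2 → P, if x (p 0) - x (p 1) + -y = 0 then ‖kernel ℂ W 2 (fun i => ((p i, σ), i))‖ else 0)) := by
  set G := ExteriorAlgebra.map (Matrix.toLin' (gridSubMatrix L M β x τ)) W with hG
  set F : TorusSite 2 L → ℂ := fun k => selfEnergy L M β G (n, k) σ with hF
  have hL : (0 : ℝ) < (L : ℝ) ^ 2 := by have := NeZero.ne L; positivity
  have hcoeff : torusCosCoeff L (fun k => (selfEnergy L M β G (n, k) σ).re) y =
      ((L : ℝ) ^ 2)⁻¹ * (((∑ k, F k * torusChar k y).re + (∑ k, F k * torusChar k (-y)).re) / 2) := by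
    unfold torusCosCoeff
    congr 1
    have hterm : ∀ k : TorusSite 2 L, (selfEnergy L M β G (n, k) σ).re *
        Real.cos (∑ i, latticeMomentum L k i * ((y i).valMinAbs : ℝ)) =
        ((F k * torusChar k y).re + (F k * torusChar k (-y)).re) / 2 := by
      intro k
      rw [cos_latticeMomentum_valMinAbs_eq_re, Literature.Analysis.Complex.PowerSum.re_mul_re_eq, ← torusChar_neg_right]
    simp_rw [hterm]
    rw [Complex.re_sum, Complex.re_sum, ← sum_div, ← sum_add_distrib]
  rw [hcoeff]
  have h1 := norm_sum_selfEnergy_map_gridSub_mul_torusChar_le hβ x τ W n σ y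
  have h2 := norm_sum_selfEnergy_map_gridSub_mul_torusChar_le hβ x τ W n σ (-y)
  have hr1 := Complex.abs_re_le_norm (∑ k, F k * torusChar k y)
  have hr2 := Complex.abs_re_le_norm (∑ k, F k * torusChar k (-y))
  rw [abs_mul, abs_of_pos (inv_pos.2 hL), abs_div, abs_two]
  have htri := abs_add_le (∑ k, F k * torusChar k y).re (∑ k, F k * torusChar k (-y)).re
  have hβ0 : 0 < |β| := abs_pos.2 hβ
  calc ((L : ℝ) ^ 2)⁻¹ * (|(∑ k, F k * torusChar k y).re + (∑ k, F k * torusChar k (-y)).re| / 2)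
      ≤ ((L : ℝ) ^ 2)⁻¹ * ((‖∑ k, F k * torusChar k y‖ + ‖∑ k, F k * torusChar k (-y)‖) / 2) := by
        gcongr
        exact htri.trans (add_le_add hr1 hr2)
    _ ≤ ((L : ℝ) ^ 2)⁻¹ * ((2 / |β| * (∑ p : Fin 2 → P, if x (p 0) - x (p 1) + y = 0 then ‖kernel ℂ W 2 (fun i => ((p i, σ), i))‖ else 0) +
          2 / |β| * (∑ p : Fin 2 → P, if x (p 0) - x (p 1) + -y = 0 then ‖kernel ℂ W 2 (fun i => ((p i, σ), i))‖ else 0)) / 2) := by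
        gcongr
    _ = _ := by
        field_simp

/-! ## §3 Weighted coefficient sums (moments) from the pinned weighted sums of the grid kernel -/

/-- **MOMENTS OF THE COSINE COEFFICIENTS OF `k⃗ ↦ Re Σ((ω,k⃗),σ)` FROM THE GRID KERNEL, ANY EVEN WEIGHT `w ≥ 0`**: if for every grid point `p₀`
`Σ_{p₁} w(x⃗_{p₁} − x⃗_{p₀}) ‖kernel W 2 ((p₀,σ,+),(p₁,σ,−))‖ ≤ B`, then `Σ_y w(y) |torusCosCoeff L (Re Σ_{map S W}((ω,·),σ)) y| ≤ (2|P|/(|β|L²))·B`. -/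
theorem sum_evenWeight_abs_torusCosCoeff_re_selfEnergy_map_gridSub_le [NeZero M] {β : ℝ} (hβ : β ≠ 0) (x : P → TorusSite 2 L)
    (τ : P → ℝ) (W : GrassmannAlgebra ℂ (GridLeg P)) (n : MatsubaraIdx M) (σ : Fin 2) {w : TorusSite 2 L → ℝ} (hw0 : ∀ z, 0 ≤ w z)
    (hweven : ∀ z, w (-z) = w z) {B : ℝ}
    (hB : ∀ p₀ : P, ∑ p₁ : P, w (x p₁ - x p₀) * ‖kernel ℂ W 2 (fun i => ((![p₀, p₁] i, σ), i))‖ ≤ B) :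
    ∑ y : TorusSite 2 L, w y *
        |torusCosCoeff L (fun k => (selfEnergy L M β (ExteriorAlgebra.map (Matrix.toLin' (gridSubMatrix L M β x τ)) W) (n, k) σ).re) y| ≤
      2 * (Fintype.card P : ℝ) / (|β| * (L : ℝ) ^ 2) * B := by
  set kW : (Fin 2 → P) → ℝ := fun p => ‖kernel ℂ W 2 (fun i => ((p i, σ), i))‖ with hkW
  set d : (Fin 2 → P) → TorusSite 2 L := fun p => x (p 1) - x (p 0) with hd
  have hL : (0 : ℝ) < (L : ℝ) ^ 2 := by have := NeZero.ne L; positivity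
  have hβ0 : 0 < |β| := abs_pos.2 hβ
  -- total weighted sum over all pairs, sliced by the first point
  have htot : ∑ p : Fin 2 → P, w (d p) * kW p ≤ (Fintype.card P : ℝ) * B := by
    have e : ∑ p : Fin 2 → P, w (d p) * kW p = ∑ q : P × P, w (x q.2 - x q.1) * ‖kernel ℂ W 2 (fun i => ((![q.1, q.2] i, σ), i))‖ := by
      refine Fintype.sum_equiv (finTwoArrowEquiv P) _ _ fun p => ?_
      simp only [hkW, hd, finTwoArrowEquiv_apply]
      congr 3
      funext i; fin_cases i <;> rfl
    rw [e, Fintype.sum_prod_type]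
    calc ∑ p₀ : P, ∑ p₁ : P, w (x p₁ - x p₀) * ‖kernel ℂ W 2 (fun i => ((![p₀, p₁] i, σ), i))‖ ≤ ∑ _p₀ : P, B :=
          sum_le_sum fun p₀ _ => hB p₀
      _ = (Fintype.card P : ℝ) * B := by rw [sum_const, card_univ, nsmul_eq_mul]
  -- the two collapsed sums
  have hcond : ∀ (p : Fin 2 → P) (y : TorusSite 2 L), (x (p 0) - x (p 1) + y = 0) ↔ (y = d p) := fun p y => by
    rw [hd]; dsimp only; rw [add_eq_zero_iff_neg_eq, neg_sub, eq_comm]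
  have hcond' : ∀ (p : Fin 2 → P) (y : TorusSite 2 L), (x (p 0) - x (p 1) + -y = 0) ↔ (y = -d p) := fun p y => by
    rw [hd]; dsimp only; rw [neg_sub, add_neg_eq_zero, eq_comm]
  have hN : ∑ y : TorusSite 2 L, w y * (∑ p : Fin 2 → P, if x (p 0) - x (p 1) + y = 0 then kW p else 0) =
      ∑ p : Fin 2 → P, w (d p) * kW p := by
    simp_rw [mul_sum, mul_ite, mul_zero, hcond]
    rw [sum_comm]
    refine sum_congr rfl fun p _ => ?_
    rw [sum_ite_eq' univ (d p) (fun y => w y * kW p), if_pos (mem_univ _)]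
  have hN' : ∑ y : TorusSite 2 L, w y * (∑ p : Fin 2 → P, if x (p 0) - x (p 1) + -y = 0 then kW p else 0) =
      ∑ p : Fin 2 → P, w (d p) * kW p := by
    simp_rw [mul_sum, mul_ite, mul_zero, hcond']
    rw [sum_comm]
    refine sum_congr rfl fun p _ => ?_
    rw [sum_ite_eq' univ (-d p) (fun y => w y * kW p), if_pos (mem_univ _), hweven]
  have hpt : ∀ y, w y *
      |torusCosCoeff L (fun k => (selfEnergy L M β (ExteriorAlgebra.map (Matrix.toLin' (gridSubMatrix L M β x τ)) W) (n, k) σ).re) y| ≤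
      w y * (1 / (|β| * (L : ℝ) ^ 2) * ((∑ p : Fin 2 → P, if x (p 0) - x (p 1) + y = 0 then kW p else 0) +
        (∑ p : Fin 2 → P, if x (p 0) - x (p 1) + -y = 0 then kW p else 0))) := fun y =>
    mul_le_mul_of_nonneg_left (abs_torusCosCoeff_re_selfEnergy_map_gridSub_le hβ x τ W n σ y) (hw0 y)
  calc ∑ y, w y * |torusCosCoeff L (fun k =>
          (selfEnergy L M β (ExteriorAlgebra.map (Matrix.toLin' (gridSubMatrix L M β x τ)) W) (n, k) σ).re) y|
      ≤ ∑ y, w y * (1 / (|β| * (L : ℝ) ^ 2) * ((∑ p : Fin 2 → P, if x (p 0) - x (p 1) + y = 0 then kW p else 0) +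
          (∑ p : Fin 2 → P, if x (p 0) - x (p 1) + -y = 0 then kW p else 0))) := sum_le_sum fun y _ => hpt y
    _ = 1 / (|β| * (L : ℝ) ^ 2) * ((∑ y : TorusSite 2 L, w y * (∑ p : Fin 2 → P, if x (p 0) - x (p 1) + y = 0 then kW p else 0)) +
          (∑ y : TorusSite 2 L, w y * (∑ p : Fin 2 → P, if x (p 0) - x (p 1) + -y = 0 then kW p else 0))) := by
        rw [← sum_add_distrib, mul_sum]
        refine sum_congr rfl fun y _ => ?_
        ring
    _ = 1 / (|β| * (L : ℝ) ^ 2) * (∑ p : Fin 2 → P, w (d p) * kW p + ∑ p : Fin 2 → P, w (d p) * kW p) := by rw [hN, hN']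
    _ ≤ 1 / (|β| * (L : ℝ) ^ 2) * ((Fintype.card P : ℝ) * B + (Fintype.card P : ℝ) * B) := by gcongr
    _ = 2 * (Fintype.card P : ℝ) / (|β| * (L : ℝ) ^ 2) * B := by
        field_simp
        ring

/-- **The same for the localised (spin- and `±ω₀`-averaged) data** `loc(G) = ¼Σ_σ[Re Σ_G((ω₀,·),σ) + Re Σ_G((−ω₀,·),σ)]`, `G = map S W`:
if the pinned weighted grid sums are `≤ B` for both spin strings, then `Σ_y w(y) |loc(G)_c(y)| ≤ (2|P|/(|β|L²))·B`. -/
theorem sum_evenWeight_abs_torusCosCoeff_locRe_map_gridSub_le [NeZero M] {β : ℝ} (hβ : β ≠ 0) (x : P → TorusSite 2 L)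
    (τ : P → ℝ) (W : GrassmannAlgebra ℂ (GridLeg P)) {w : TorusSite 2 L → ℝ} (hw0 : ∀ z, 0 ≤ w z)
    (hweven : ∀ z, w (-z) = w z) {B : ℝ}
    (hB : ∀ (σ : Fin 2) (p₀ : P), ∑ p₁ : P, w (x p₁ - x p₀) * ‖kernel ℂ W 2 (fun i => ((![p₀, p₁] i, σ), i))‖ ≤ B) :
    ∑ y : TorusSite 2 L, w y *
        |torusCosCoeff L (fun k => (∑ σ : Fin 2,
          ((selfEnergy L M β (ExteriorAlgebra.map (Matrix.toLin' (gridSubMatrix L M β x τ)) W) (omega0 M, k) σ).re +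
           (selfEnergy L M β (ExteriorAlgebra.map (Matrix.toLin' (gridSubMatrix L M β x τ)) W) ((omega0 M).rev, k) σ).re)) / 4) y| ≤
      2 * (Fintype.card P : ℝ) / (|β| * (L : ℝ) ^ 2) * B := by
  set G := ExteriorAlgebra.map (Matrix.toLin' (gridSubMatrix L M β x τ)) W with hG
  set f : MatsubaraIdx M → Fin 2 → TorusSite 2 L → ℝ := fun m σ k => (selfEnergy L M β G (m, k) σ).re with hf
  set Bt : ℝ := 2 * (Fintype.card P : ℝ) / (|β| * (L : ℝ) ^ 2) * B with hBt
  have hdata : (fun k => (∑ σ : Fin 2, ((selfEnergy L M β G (omega0 M, k) σ).re +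
      (selfEnergy L M β G ((omega0 M).rev, k) σ).re)) / 4) = fun k => (1 / 4 : ℝ) *
      ((f (omega0 M) 0 k + f (omega0 M).rev 0 k) + (f (omega0 M) 1 k + f (omega0 M).rev 1 k)) := by
    funext k
    simp only [hf, Fin.sum_univ_two]
    ring
  have hcoeff : ∀ y, torusCosCoeff L (fun k => (∑ σ : Fin 2, ((selfEnergy L M β G (omega0 M, k) σ).re +
      (selfEnergy L M β G ((omega0 M).rev, k) σ).re)) / 4) y = (1 / 4 : ℝ) *
      ((torusCosCoeff L (f (omega0 M) 0) y + torusCosCoeff L (f (omega0 M).rev 0) y) +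
        (torusCosCoeff L (f (omega0 M) 1) y + torusCosCoeff L (f (omega0 M).rev 1) y)) := by
    intro y
    rw [hdata, torusCosCoeff_const_mul, torusCosCoeff_add L (fun k => f (omega0 M) 0 k + f (omega0 M).rev 0 k)
      (fun k => f (omega0 M) 1 k + f (omega0 M).rev 1 k), torusCosCoeff_add, torusCosCoeff_add]
  have hb : ∀ (m : MatsubaraIdx M) (σ : Fin 2), ∑ y, w y * |torusCosCoeff L (f m σ) y| ≤ Bt := fun m σ =>
    sum_evenWeight_abs_torusCosCoeff_re_selfEnergy_map_gridSub_le hβ x τ W m σ hw0 hweven (hB σ)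
  have hpt : ∀ y, w y * |torusCosCoeff L (fun k => (∑ σ : Fin 2, ((selfEnergy L M β G (omega0 M, k) σ).re +
      (selfEnergy L M β G ((omega0 M).rev, k) σ).re)) / 4) y| ≤ (1 / 4 : ℝ) *
      ((w y * |torusCosCoeff L (f (omega0 M) 0) y| + w y * |torusCosCoeff L (f (omega0 M).rev 0) y|) +
        (w y * |torusCosCoeff L (f (omega0 M) 1) y| + w y * |torusCosCoeff L (f (omega0 M).rev 1) y|)) := by
    intro y
    rw [hcoeff, abs_mul, abs_of_pos (by norm_num : (0 : ℝ) < 1 / 4)]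
    have h1 := abs_add_le (torusCosCoeff L (f (omega0 M) 0) y + torusCosCoeff L (f (omega0 M).rev 0) y)
      (torusCosCoeff L (f (omega0 M) 1) y + torusCosCoeff L (f (omega0 M).rev 1) y)
    have h2 := abs_add_le (torusCosCoeff L (f (omega0 M) 0) y) (torusCosCoeff L (f (omega0 M).rev 0) y)
    have h3 := abs_add_le (torusCosCoeff L (f (omega0 M) 1) y) (torusCosCoeff L (f (omega0 M).rev 1) y)
    have hwy := hw0 y
    nlinarith
  calc ∑ y, w y * |torusCosCoeff L (fun k => (∑ σ : Fin 2, ((selfEnergy L M β G (omega0 M, k) σ).re +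
          (selfEnergy L M β G ((omega0 M).rev, k) σ).re)) / 4) y|
      ≤ ∑ y, (1 / 4 : ℝ) * ((w y * |torusCosCoeff L (f (omega0 M) 0) y| + w y * |torusCosCoeff L (f (omega0 M).rev 0) y|) +
          (w y * |torusCosCoeff L (f (omega0 M) 1) y| + w y * |torusCosCoeff L (f (omega0 M).rev 1) y|)) :=
        sum_le_sum fun y _ => hpt y
    _ = (1 / 4 : ℝ) * ((∑ y, w y * |torusCosCoeff L (f (omega0 M) 0) y| + ∑ y, w y * |torusCosCoeff L (f (omega0 M).rev 0) y|) +
          (∑ y, w y * |torusCosCoeff L (f (omega0 M) 1) y| + ∑ y, w y * |torusCosCoeff L (f (omega0 M).rev 1) y|)) := by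
        rw [← mul_sum, sum_add_distrib, sum_add_distrib, sum_add_distrib]
    _ ≤ (1 / 4 : ℝ) * ((Bt + Bt) + (Bt + Bt)) := by
        gcongr
        · exact hb _ _
        · exact hb _ _
        · exact hb _ _
        · exact hb _ _
    _ = Bt := by ring

/-! ## §4 The cell's K-separated data from a grid element: momentum-side sizes and the scale-0 response -/

section Model

variable [NeZero M]

/-- **MOMENTUM-SIDE SIZES OF THE K-SEPARATED DATA FROM A GRID ELEMENT** (input `hm` of `twoLegCoreT_zero_of_momentumSizes[_stub5]`): if
`𝒱⁽ⁿ⁾ − 𝒩_K = map S W` for a grid element `W` (`S = gridSubMatrix β x τ`) whose two-leg kernels have pinned sums `≤ B₀` (weight `1`) and pinned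
OFF-DIAGONAL weighted sums `≤ Bₖ` (weight `[z ≠ 0](1+|z̃₀|+|z̃₁|)ᵏ`, k = 1, 2), then for `k ≤ 2`
`‖Dᵏ evalM (symInterp L (σ_n − K∘p))‖ ≤ (2|P|/(|β|L²))·(B₀ | Bₖ)`. -/
theorem twoLeg_sep_momentumSizes_of_grid {β : ℝ} (hβ : β ≠ 0) (U μ : ℝ) (K : TrigPolyC4v) (n : ℕ) (x : P → TorusSite 2 L)
    (τ : P → ℝ) (W : GrassmannAlgebra ℂ (GridLeg P))
    (hW : klEffectiveAction L M β U μ K klE0 n - counterQuadratic L M β K =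
      ExteriorAlgebra.map (Matrix.toLin' (gridSubMatrix L M β x τ)) W)
    {B : ℕ → ℝ}
    (hB0 : ∀ (σ : Fin 2) (p₀ : P), ∑ p₁ : P, ‖kernel ℂ W 2 (fun i => ((![p₀, p₁] i, σ), i))‖ ≤ B 0)
    (hBk : ∀ k, 1 ≤ k → k ≤ 2 → ∀ (σ : Fin 2) (p₀ : P), ∑ p₁ : P,
      (if x p₁ - x p₀ = 0 then (0 : ℝ) else
        (1 + (((x p₁ - x p₀) 0).valMinAbs.natAbs : ℝ) + (((x p₁ - x p₀) 1).valMinAbs.natAbs : ℝ)) ^ k) *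
        ‖kernel ℂ W 2 (fun i => ((![p₀, p₁] i, σ), i))‖ ≤ B k) :
    ∀ k ≤ 2, ∀ q : Momentum, ‖iteratedFDeriv ℝ k
      (evalM (symInterp L (fun p => klLocSelfEnergyRe L M β U μ K n p - K.eval (latticeMomentum L p)))) q‖ ≤
        2 * (Fintype.card P : ℝ) / (|β| * (L : ℝ) ^ 2) * B k := by
  intro k hk q
  have hfun : (fun p => klLocSelfEnergyRe L M β U μ K n p - K.eval (latticeMomentum L p)) =
      fun p => (∑ σ : Fin 2, ((selfEnergy L M β (ExteriorAlgebra.map (Matrix.toLin' (gridSubMatrix L M β x τ)) W) (omega0 M, p) σ).re +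
        (selfEnergy L M β (ExteriorAlgebra.map (Matrix.toLin' (gridSubMatrix L M β x τ)) W) ((omega0 M).rev, p) σ).re)) / 4 := by
    funext p
    rw [klLocSelfEnergyRe_sub_frame_eq_locRe hβ U μ K n p, hW]
  rw [hfun]
  rcases Nat.eq_zero_or_pos k with rfl | hkpos
  · refine (norm_iteratedFDeriv_zero_evalM_symInterp_le L _ q).trans ?_
    have h := sum_evenWeight_abs_torusCosCoeff_locRe_map_gridSub_le (L := L) (M := M) hβ x τ W (w := fun _ => (1 : ℝ))
      (fun _ => zero_le_one) (fun _ => rfl) (B := B 0) (fun σ p₀ => by simpa only [one_mul] using hB0 σ p₀)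
    simpa only [one_mul] using h
  · refine (norm_iteratedFDeriv_evalM_symInterp_le_offZero_moments L _ hkpos q).trans ?_
    set w : TorusSite 2 L → ℝ := fun z =>
      if z = 0 then (0 : ℝ) else (1 + ((z 0).valMinAbs.natAbs : ℝ) + ((z 1).valMinAbs.natAbs : ℝ)) ^ k with hw
    have hw0 : ∀ z, 0 ≤ w z := fun z => by rw [hw]; dsimp only; split_ifs <;> positivity
    have hweven : ∀ z, w (-z) = w z := fun z => by simp only [hw]; exact offDiagWeight_neg k z
    have h := sum_evenWeight_abs_torusCosCoeff_locRe_map_gridSub_le (L := L) (M := M) hβ x τ W hw0 hweven (B := B k)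
      (fun σ p₀ => hBk k hkpos hk σ p₀)
    refine le_trans (le_of_eq ?_) h
    rw [sum_filter]
    refine sum_congr rfl fun y _ => ?_
    simp only [hw]
    by_cases hy : y = 0
    · rw [if_neg (not_not.2 hy), if_pos hy, zero_mul]
    · rw [if_pos hy, if_neg hy]

/-- **THE SCALE-0 (E3c) RESPONSE FROM A GRID ELEMENT, band-limited frames** (input `hr₀` of `twoLegCoreT_zero_of_momentumSizes[_stub5]`):
if `(𝒱⁽⁰⁾_K − 𝒩_K) − (𝒱⁽⁰⁾_{K'} − 𝒩_{K'}) = map S W` with pinned sums `Σ_{p₁} ‖kernel W 2 (p₀,p₁)‖ ≤ ρ` for every `p₀` and both spin strings,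
then `|(S₀ᴷ − K)(p) − (S₀^{K'} − K')(p)| ≤ (2|P|/(|β|L²))·ρ` at every `p`. -/
theorem abs_scaleZero_response_le_of_grid {β : ℝ} (hβ : β ≠ 0) (U μ : ℝ) (K K' : TrigPolyC4v)
    (hband : ∀ m n, m ≤ K.degree → n ≤ K.degree → (L / 2 < m ∨ L / 2 < n) → K.coeff m n = 0)
    (hband' : ∀ m n, m ≤ K'.degree → n ≤ K'.degree → (L / 2 < m ∨ L / 2 < n) → K'.coeff m n = 0)
    (x : P → TorusSite 2 L) (τ : P → ℝ) (W : GrassmannAlgebra ℂ (GridLeg P))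
    (hW : (klEffectiveAction L M β U μ K klE0 0 - counterQuadratic L M β K) -
        (klEffectiveAction L M β U μ K' klE0 0 - counterQuadratic L M β K') =
      ExteriorAlgebra.map (Matrix.toLin' (gridSubMatrix L M β x τ)) W)
    {ρ : ℝ} (hρ : ∀ (σ : Fin 2) (p₀ : P), ∑ p₁ : P, ‖kernel ℂ W 2 (fun i => ((![p₀, p₁] i, σ), i))‖ ≤ ρ) (p : Fin 2 → ℝ) :
    |((symInterp L (klLocSelfEnergyRe L M β U μ K 0)).eval p - K.eval p) -
        ((symInterp L (klLocSelfEnergyRe L M β U μ K' 0)).eval p - K'.eval p)| ≤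
      2 * (Fintype.card P : ℝ) / (|β| * (L : ℝ) ^ 2) * ρ := by
  set G := ExteriorAlgebra.map (Matrix.toLin' (gridSubMatrix L M β x τ)) W with hG
  -- the K-subtracted readings are the interpolants of the K-separated data (band-limited frames: no aliasing)
  have hread : ∀ (X : TrigPolyC4v), (∀ m n, m ≤ X.degree → n ≤ X.degree → (L / 2 < m ∨ L / 2 < n) → X.coeff m n = 0) →
      (symInterp L (klLocSelfEnergyRe L M β U μ X 0)).eval p - X.eval p =
        (symInterp L (fun k => klLocSelfEnergyRe L M β U μ X 0 k - X.eval (latticeMomentum L k))).eval p := by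
    intro X hX
    rw [eval_symInterp_sub L (klLocSelfEnergyRe L M β U μ X 0) (fun k => X.eval (latticeMomentum L k)),
      eval_symInterp_latticeValues_of_bandLimited L X hX]
  rw [hread K hband, hread K' hband', ← eval_symInterp_sub]
  -- the double difference of the data is the localised data of `G`
  have hdata : (fun k : TorusSite 2 L => (klLocSelfEnergyRe L M β U μ K 0 k - K.eval (latticeMomentum L k)) -
      (klLocSelfEnergyRe L M β U μ K' 0 k - K'.eval (latticeMomentum L k))) =
      fun k => (∑ σ : Fin 2, ((selfEnergy L M β G (omega0 M, k) σ).re + (selfEnergy L M β G ((omega0 M).rev, k) σ).re)) / 4 := by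
    funext k
    rw [klLocSelfEnergyRe_sub_frame_eq_locRe hβ U μ K 0 k, klLocSelfEnergyRe_sub_frame_eq_locRe hβ U μ K' 0 k, ← hW]
    simp only [selfEnergy_sub, Complex.sub_re, Fin.sum_univ_two]
    ring
  rw [hdata]
  have h := sum_evenWeight_abs_torusCosCoeff_locRe_map_gridSub_le (L := L) (M := M) hβ x τ W (w := fun _ => (1 : ℝ))
    (fun _ => zero_le_one) (fun _ => rfl) (B := ρ) (fun σ p₀ => by simpa only [one_mul] using hρ σ p₀)
  simp only [one_mul] at h
  exact (abs_symInterp_eval_le _ p).trans h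

end Model

end Summit.HubbardSuperconductivity.HubbardSuperconductivity.Theorems.TwoLegFourier

end
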